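import Literature.AlgebraicGeometry.HodgeTheory.RelativeHyperplaneClassHodgeRiemann
import Literature.AlgebraicGeometry.HodgeTheory.DirectImageTransport
import Literature.AlgebraicGeometry.HodgeTheory.AlgebraicMonodromyMumfordTate
import Literature.AlgebraicGeometry.HodgeTheory.BettiUniverseTracePairing
import Literature.AlgebraicGeometry.HodgeTheory.BettiUniverseKunnethHodgePowersNormalForm
import Literature.AlgebraicGeometry.HodgeTheory.CyclicCoverReflectionMonodromy
import Literature.AlgebraicGeometry.HodgeTheory.ComplexConjugationHolds
import HarnessLib

/-!
# Route `Q8SymplecticPowers`, crux K1Q «mechanism-v5» — glue S7, brick G5: the trace form `tr(x ∪ y)` is NON-DEGENERATE on the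
# finite-orbit part `N ⊆ H²(X_t; ℚ)` once `N` consists of Hodge classes (Hodge index: Hodge–Riemann on the rational (1,1)-classes
# + the flat hyperplane class lies in `N`)

Support file for crux K1Q (stmt-HodgeConjecture-24190; `--supports … --as helper`; nothing here closes an item). Prover seat
`hodge-nonav-19716-p2` (g14), owner of stub S7 `stub_transportHeredityQ`. Hypothesis (hNQ) `Qf|_N` non-degenerate of the restriction
currency `mem_glIdentityComponent_of_variablePart`, in the POINT CURRENCY of S4 ∕ S5 ∕ S7:

* `eta_mem_span_finiteIndexFixed` — the rational Kähler class `η` of a Kähler–rational datum of `X_t` whose complex class is the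
  restriction of a GLOBAL class of the total space is fixed by the whole monodromy group (restrictions of global classes are flat,
  `transportFun_map_fiberι`), hence lies in `N`.
* **`tr_cup_nondegenerate_on_span_finiteIndexFixed`** — for a smooth projective family of surfaces `π : 𝒳 ⟶ S` with `𝒳`, `S`
  quasi-projective and `t ∈ S(ℂ)`: if `N ≤ Hdg¹(H²(X_t))` (brick G3) then `x ∈ N`, `tr(x ∪ y) = 0` for all `y ∈ N` force `x = 0`.
  PROOF (Hodge index): with the Kähler–rational datum `D` of `X_t ⊂ 𝒳 ⊂ ℙᴺ` (`exists_kaehlerRationalDatum_eq_map`), `η ∈ N`, so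
  `x ∪ η = 0` and `x ∪ x = 0` (`tr` is injective on `H⁴`); the first says `x` is Lefschetz-PRIMITIVE for `η`, so the polarisation form
  of `D` is `Q(x, x) = −τ(x ∪ x) = 0` (`polarizationForm_apply`, `hodgeRiemannPairing_apply`); but `x ⊗ 1` is a non-zero rational
  `(1,1)`-class, on which `Q_ℂ(x, x̄) = Q(x,x) > 0` (`KaehlerRationalDatum.cform_conj_pos`, `algebraMap_form`) — contradiction.

HONEST FRAMING: assembly of tree theorems (axioms standard, no named fact); K1Q ∕ HC ∕ HC_AV NOT proved; item 24190 OPEN.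

## References
* [VoisinHodgeI2002] C. Voisin, Hodge Theory and Complex Algebraic Geometry I, CUP 2002, §6.2.3 Cor. 6.26, §6.3.2 Thm. 6.32, §7.1.2.
* [VoisinHodgeII2003] C. Voisin, Hodge Theory and Complex Algebraic Geometry II, CUP 2003, §3.1.2.
-/

noncomputable section

set_option linter.dupNamespace false

namespace Summit.HodgeConjecture.HodgeConjecture.Theorems.Q8SymplecticPowersFiniteOrbitPartNondegenerate

open CategoryTheory CategoryTheory.Limits AlgebraicGeometry
open Literature.AlgebraicGeometry.Motives Literature.AlgebraicGeometry.HodgeTheory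
open Literature.AlgebraicGeometry.HodgeTheory.BettiUniverse
open Literature.AlgebraicTopology.SingularHomology Literature.Geometry.Kaehler
open scoped TensorProduct

/-! ### §1 The flat rational Kähler class lies in the finite-orbit part -/

/-- **A rational class whose complexification is the restriction of a global class is fixed by the monodromy group**, hence lies in
the finite-orbit span `N` (with `Γ' = Γ_t` itself). [cite: VoisinHodgeII2003, §3.1.2] -/
theorem mem_span_finiteIndexFixed_of_eq_map_fiberι {𝒳 S : SchemeOver ℂ} (π : 𝒳 ⟶ S) (k : ℕ)
    (hU : IsCohomologicallyLocallyTrivialOn π (Set.univ : Set (ComplexPoints S))) (t : ComplexPoints S)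
    {η : bettiCohomology (fiberOver π t) k} {K : complexBetti 𝒳 k}
    (hη : ofRatClass _ k η = complexBetti.map (fiberι π t) k K) :
    η ∈ Submodule.span ℚ {x : bettiCohomology (fiberOver π t) k |
        ∃ Γ' : Subgroup (bettiCohomology (fiberOver π t) k ≃ₗ[ℚ] bettiCohomology (fiberOver π t) k),
          Γ' ≤ ratMonodromyGroup π k hU ⟨t, Set.mem_univ t⟩ ∧
          (Γ'.subgroupOf (ratMonodromyGroup π k hU ⟨t, Set.mem_univ t⟩)).FiniteIndex ∧ ∀ γ ∈ Γ', γ x = x} := by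
  refine Submodule.subset_span ⟨ratMonodromyGroup π k hU ⟨t, Set.mem_univ t⟩, le_rfl, ?_, fun γ hγ => ?_⟩
  · rw [Subgroup.subgroupOf_self]; infer_instance
  · obtain ⟨δ, hδ⟩ := (mem_ratMonodromyGroup_iff π k hU ⟨t, Set.mem_univ t⟩ γ).1 hγ
    apply ofRatClass_injective
    rw [hδ η, hη]
    exact transportFun_map_fiberι π k hU δ K

/-! ### §2 Hodge index on the finite-orbit part -/

/-- **G5: the trace form is non-degenerate on `N` once `N ≤ Hdg¹`.** See the module docstring.
[cite: VoisinHodgeI2002, §6.3.2 Thm. 6.32 and §7.1.2] -/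
theorem tr_cup_nondegenerate_on_span_finiteIndexFixed {𝒳 S : SchemeOver ℂ} (π : 𝒳 ⟶ S) (hπ : IsSmoothProjectiveFamily π 2)
    (h𝒳 : IsQuasiProjectiveOver 𝒳) (hS : IsQuasiProjectiveOver S)
    (hU : IsCohomologicallyLocallyTrivialOn π (Set.univ : Set (ComplexPoints S))) (t : ComplexPoints S)
    (hN1 : Submodule.span ℚ {x : bettiCohomology (fiberOver π t) 2 |
        ∃ Γ' : Subgroup (bettiCohomology (fiberOver π t) 2 ≃ₗ[ℚ] bettiCohomology (fiberOver π t) 2),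
          Γ' ≤ ratMonodromyGroup π 2 hU ⟨t, Set.mem_univ t⟩ ∧
          (Γ'.subgroupOf (ratMonodromyGroup π 2 hU ⟨t, Set.mem_univ t⟩)).FiniteIndex ∧ ∀ γ ∈ Γ', γ x = x} ≤
      (hodge exists_isReal_hodgeModel_holds (hπ.isSmoothProjective t) 2).hodgeClasses 1) :
    ∀ x ∈ Submodule.span ℚ {x : bettiCohomology (fiberOver π t) 2 |
        ∃ Γ' : Subgroup (bettiCohomology (fiberOver π t) 2 ≃ₗ[ℚ] bettiCohomology (fiberOver π t) 2),
          Γ' ≤ ratMonodromyGroup π 2 hU ⟨t, Set.mem_univ t⟩ ∧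
          (Γ'.subgroupOf (ratMonodromyGroup π 2 hU ⟨t, Set.mem_univ t⟩)).FiniteIndex ∧ ∀ γ ∈ Γ', γ x = x},
      (∀ y ∈ Submodule.span ℚ {x : bettiCohomology (fiberOver π t) 2 |
          ∃ Γ' : Subgroup (bettiCohomology (fiberOver π t) 2 ≃ₗ[ℚ] bettiCohomology (fiberOver π t) 2),
            Γ' ≤ ratMonodromyGroup π 2 hU ⟨t, Set.mem_univ t⟩ ∧
            (Γ'.subgroupOf (ratMonodromyGroup π 2 hU ⟨t, Set.mem_univ t⟩)).FiniteIndex ∧ ∀ γ ∈ Γ', γ x = x},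
        LinearMap.compr₂ (cup (fiberOver π t) 2 2) (tr (hπ.isSmoothProjective t) (2 + 2)) x y = 0) → x = 0 := by
  classical
  intro x hx hx0
  have hXt : IsSmoothProjective 2 (fiberOver π t) := hπ.isSmoothProjective t
  haveI := finite hXt 2
  -- ### the Kähler–rational datum of `X_t ⊂ 𝒳 ⊂ ℙᴺ`
  obtain ⟨N', ε, hε⟩ := IsQuasiProjectiveOver.exists_isPreimmersion h𝒳
  haveI := hε
  haveI := hπ.isProper
  haveI : IsSeparated S.hom := IsQuasiProjectiveOver.isSeparated hS
  haveI : IsClosedImmersion (fiberι π t ≫ ε).left := isClosedImmersion_fiberι_comp_left_of_isPreimmersion π ε t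
  obtain ⟨D, c, hc⟩ := exists_kaehlerRationalDatum_eq_map hXt (fiberι π t ≫ ε)
  let A : HodgeModel 2 (fiberOver π t) := realHodgeModel exists_isReal_hodgeModel_holds hXt
  have hA : A.IsHodgeSymmetric := realHodgeModel_isHodgeSymmetric exists_isReal_hodgeModel_holds hXt
  -- `η ∈ N`
  have hηN := mem_span_finiteIndexFixed_of_eq_map_fiberι π 2 hU t (η := D.η) (K := complexBetti.map ε 2 c)
    (by rw [← ModuleCat.comp_apply, ← complexBetti.map_comp]; exact hc)
  -- ### `x ∪ η = 0` and `x ∪ x = 0`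
  have hinj := tr_top_injective hXt
  have hxη : cup (fiberOver π t) 2 2 x D.η = 0 := by
    have h := hx0 D.η hηN
    rw [LinearMap.compr₂_apply] at h
    exact hinj (h.trans (map_zero _).symm)
  have hηx : cup (fiberOver π t) 2 2 D.η x = 0 := by rw [BettiUniverse.cup_comm_of_even (by decide), hxη]
  have hxx : cup (fiberOver π t) 2 2 x x = 0 := by
    have h := hx0 x hx
    rw [LinearMap.compr₂_apply] at h
    exact hinj (h.trans (map_zero _).symm)
  -- ### `x` is Lefschetz-primitive for `η`
  have hprim : x ∈ primitiveClasses D.η 2 2 := by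
    refine ⟨fun h => absurd h (lt_irrefl 2), fun r m h hr => ?_⟩
    obtain rfl : r = 1 := by omega
    subst h
    rw [lefschetzPowTo_succ_apply D.η 0 2 2 (2 + 2 * 1) rfl rfl rfl, lefschetzOperator_apply]
    exact hηx
  have hsum : x ∈ lefschetzSummand D.η 2 2 ⟨(2, 0), rfl⟩ := lefschetzPowTo_mem_lefschetzSummand rfl hprim
  -- ### the polarisation form of `D` vanishes on `(x, x)`
  have hform : D.form hXt 2 x x = 0 := by
    rw [KaehlerRationalDatum.form, polarizationForm_apply]
    refine Finset.sum_eq_zero fun p _ => ?_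
    by_cases hp : p = ⟨(2, 0), rfl⟩
    · subst hp
      have hξ : primitivePart D.η 2 (D.hLℚ hXt) (subsingleton_of_lt hXt ℚ) ⟨(2, 0), rfl⟩ x = x :=
        primitivePart_lefschetzPowTo_of_mem (D.hLℚ hXt) (subsingleton_of_lt hXt ℚ) ⟨(2, 0), rfl⟩ (by norm_num) hprim
      rw [hξ, hodgeRiemannPairing_apply (D.ratTrace hXt) (show 2 + 0 = 2 from rfl) (show 2 + 2 * 0 = 2 from rfl)
        (show 2 + 2 = 2 * 2 from rfl) x x]
      have h0 : cupProduct (show 2 + 2 = 2 * 2 from rfl) (lefschetzPowTo D.η 0 2 2 (show 2 + 2 * 0 = 2 from rfl) x) x = 0 := hxx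
      rw [h0, map_zero, mul_zero]
    · rw [primitivePart_eq_zero_of_mem_ne (D.hLℚ hXt) (subsingleton_of_lt hXt ℚ) (Ne.symm hp) hsum, map_zero]
  -- ### but `x ⊗ 1` is a non-zero rational (1,1)-class, on which the form is positive
  by_contra hx_ne
  have hX11 : ofRatClass _ 2 x ∈ A.typePiece 2 ⟨(1, 1), by simp⟩ := by
    rw [HodgeModel.mem_typePiece_iff]
    exact (HodgeModel.mem_hodgeClasses_iff A hXt hA 1 x).1 (hN1 hx)
  obtain ⟨r, hr, hQ⟩ := D.cform_conj_pos hXt A (p := 1) (q := 1) (k := 2) (by simp) hX11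
    (fun h0 => hx_ne (ofRatClass_injective 2 (by rw [h0, map_zero])))
  rw [conjClass_ofRatClass, sub_self, zpow_zero, one_mul, ← D.algebraMap_form hXt, hform, map_zero] at hQ
  have : (r : ℂ) = 0 := hQ.symm
  exact (ne_of_gt hr) (by exact_mod_cast this)

end Summit.HodgeConjecture.HodgeConjecture.Theorems.Q8SymplecticPowersFiniteOrbitPartNondegenerate

end
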